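import Summits.QuantumFields.BalabanUV.T4Continuum.Support.NE9CurChartTowerPiLatticeUniformClassW80
import Summits.QuantumFields.BalabanUV.T4Continuum.Support.NE9CurOfOneInstanceChartEnd

/-!
# NE9CurOfTowerPiChartEndLatticeUniformW80 — T25's END FACE READ AT THE LATTICE-UNIFORM k-LEVEL CHART OF `cur U` ON PRINT's CLASS: NE9 leaf-06's END-COMP
# (`NE9CurveFromBackgroundMapEnd.termSize_ne9_and_fadingMemory_compCur_margProj_cpieceForm`, through (C′) §1
# `Support/NE9CurOfOneInstanceChartEnd.termSize_ne9_and_fadingMemory_compCur_of_chart` — ANY chart with (Ψ1)–(Ψ3), read per domain) FED by this seat's (I-7)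
# `Support/NE9CurChartTowerPiLatticeUniformClass.cur_chart_exists_tower_pi_of_unitary_class_lattice_uniform` — the chart of print's `k`-th-step operator (3.122) for
# EVERY height, spacing, period and unitary small background, whose radii `ε₄ ε_C R_b R′` and windows `α₁ j₁` precede the lattice; so the readings' ball
# inclusions are against radii FIXED BEFORE the lattice and the END face `TermSize ∧ NE9 ∧ FadingMemory` holds «⇐ the named binders» with NO chart radius
# depending on the height, the spacing, the period or the background; cell `pub-balaban`, T4-DAG §2 node U3 ∕ §6 NE9, route R2′; NE9 crux-team (2) leaf
# prover 01 (`b2b-balaban-t4-ne9-formalise-leaf-01`, gen 97); Summits-side NEW sibling leaf under this seat's INTERFACE REQUEST NE9 [NE9LEAF01-G96-IFR]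
# (pattern: ne9-leaf-05 g68's (C″) `Support/NE9CurOfOneInstanceChartEndUniform` for the one-instance chart); nothing printed asserted.  W80 VARIANT (gen 97): the (L3) `W`-slot is the CONCRETE
(80)-current `W80 ρc τc U H̃_{1,k} C_k ε_C J Δπ` of `Literature.….B11Eq80Current`, whose (98)-letter `C₄` and radius `R′` are LATTICE-FREE by
`Literature.….B11Ineq98W80LatticeFree.exists_quadAnalytic_W80_latticeFree` (kernel route (73)→(86)); the chart is (I-7-W80)
`Support/NE9CurChartTowerPiLatticeUniformClassW80.cur_chart_exists_tower_pi_of_unitary_class_lattice_uniform_W80`; otherwise verbatim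

HONEST FRAMING (T4-DAG PAGE 1).  Rung (B)+1 of the FINITE-VOLUME T⁴ programme — NOT infinite volume, NOT a mass gap, NOT the Clay problem.  NE9
(`T4OutputRate.NE9` ∧ `FadingMemory`) is a cell NEW ESTIMATE, NOT PRINTED in [I] = [Balaban1987RG1] (CMP **109**), [II] = [Balaban1988RG2Cluster]
(CMP **116**), and NOT PROVED here («NE9 ⇐ the named binders»; spine PROVED 0∕9).  HONEST DEPENDENCY (cell line, verbatim): continuum YM on T⁴ ⇐
BetaPertH ∧ nine spine estimates (0/9 proved); BetaPertH ⇐ (D1) ∧ (D4) ∧ CAP+tail; G-an2-4 gates asym, D1 and NE2/3/4.  The `cur U` OBJECT is ONE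
item of the MODEL O-NE9-1 (species (a) data); the END's `act` ∕ `ker` halves and NEEDS-COORDINATOR #5 are untouched.

WHAT THIS FILE PROVES (ONE theorem; 0 def, 0 sorry, axioms standard).  **`termSize_ne9_and_fadingMemory_compCur_of_towerPi_lattice_uniform_W80`** — given (I-7)'s
letters (fixed `L ≥ 3`, a finite-dimensional non-trivial C⋆-algebra with fibre ∕ trace letters, `a, a′ > 0`, [4] Prop. 2's `α₀` with `C_k`'s `ρ` and the surjectivity regime,
`ρ_w`, the (L3) constants `(C₄, a₃)`, weight-profile bounds `ω_w, Ω_w`) and END-COMP's binders NOT mentioning the curve datum VERBATIM: `∃ α₁ j₁ ε₄ ε_C R_b R′`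
BEFORE `∀`, such that for EVERY height `n`, spacing `η` on the diagonal, period `m`, background `U` of print's class (3.35)–(3.36) with `α ≤ α₁`, current `‖J‖ ≤ j₀ ≤ j₁`,
level maps and (L3) slot as in (I-7): `∃ h52 hpos′ hposπ` (PRODUCED) and, for ALL per-domain readings `ιr X`, `πr X` with `ιr X (ball 0 (Dd.R X)) ⊆ ball 0 R_b`,
`πr X (ball 0 R′) ⊆ ball 0 (R₁ X)` (inclusions against the FIXED radii), every `Φ` agreeing with the read k-level chart, and the six END-COMP binders mentioning
`Dd.compCur Φ R₁`, the END face `TermSize ∧ NE9 ∧ FadingMemory` holds with END-COMP's moduli VERBATIM — «⇐ the named binders».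
MECHANISM: (I-7) + (C′) §1.
DISGUISE TEST: composition by name; no inequality of the series proved; print's class, `c₀ = η^d`, the weight-profile bounds, the (L3) `W`, the readings and ALL of
END-COMP's binders stay DISPLAYED; NOT claimed that Bałaban's 𝐇_k ∕ U_j(□₀, exp iB) ∕ U^c_j meet the readings' inclusions or END-COMP's binders (O-NE9-1 ∕ O-NE9-5;
#5 UNRULED); not NE9.  What IS new relative to (C″): the chart is the k-LEVEL one at print's operator and NO radius depends on the lattice or the height.
References (TYPES ∕ loci only): [Balaban1985Variational] (45)–(47) p. 285, (103) p. 293, Prop. 6 (117)–(121) p. 295, (172)–(175) p. 305; [Balaban1985BackgroundPropagators]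
(3.35)–(3.37) p. 396, Thm 3.11 p. 416, (3.122) p. 420, Thm 3.12 p. 423, Thm 3.13 p. 426; [Balaban1987RG1] (1.18) p. 256, Lemma 4 (3.53) p. 280; [Balaban1988RG2Cluster]
Lemma 1 (1.36), Lemma 2 (1.41)–(1.43), (2.15)–(2.22).
-/

noncomputable section

namespace Summit.QuantumFields.BalabanUV.T4Continuum.NE9CurOfTowerPiChartEndLatticeUniformW80

open scoped BigOperators InnerProductSpace ComplexConjugate
open Metric Set
open Literature.MathematicalPhysics.QuantumFieldTheory.Balaban1983to89
open Literature.MathematicalPhysics.QuantumFieldTheory.Balaban1983to89.T4OutputRate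
open Literature.MathematicalPhysics.QuantumFieldTheory.Balaban1983to89.T4HistoryLipschitzRecursion
open Literature.MathematicalPhysics.QuantumFieldTheory.Balaban1983to89.T4HistoryLipschitzOuter
open Literature.MathematicalPhysics.QuantumFieldTheory.Balaban1983to89.T4HistoryLipschitzActivity
open Literature.MathematicalPhysics.QuantumFieldTheory.Balaban1983to89.T4HistoryLipschitzActivity (ClusterGeom)
open Literature.MathematicalPhysics.QuantumFieldTheory.Balaban1983to89.T4HistoryLipschitzSegment
open Summit.QuantumFields.BalabanUV.T4Continuum.NE9Lemma1Counting
open Summit.QuantumFields.BalabanUV.T4Continuum.NE9Lemma1Gain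
open Summit.QuantumFields.BalabanUV.T4Continuum.NE9Lemma1PieceClass
open Summit.QuantumFields.BalabanUV.T4Continuum.NE9Lemma1RemainderSpecies
open Summit.QuantumFields.BalabanUV.T4Continuum.NE9Lemma1CurveSpecies
open Summit.QuantumFields.BalabanUV.T4Continuum.NE9ComplexEncoding (doubleCarriers)
open Summit.QuantumFields.BalabanUV.T4Continuum.NE9LastCouplingBridge
open Summit.QuantumFields.BalabanUV.T4Continuum.NE9BridgeSizeInduction
open Summit.QuantumFields.BalabanUV.T4Continuum.NE9MarginalProjection
open Summit.QuantumFields.BalabanUV.T4Continuum.NE9MarginalProjectionEnd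
open Summit.QuantumFields.BalabanUV.T4Continuum.NE9CurveFromBackgroundMap
open Summit.QuantumFields.BalabanUV.T4Continuum.NE9CurveFromBackgroundMapEnd (termSize_ne9_and_fadingMemory_compCur_margProj_cpieceForm)
open Summit.QuantumFields.BalabanUV.T4Continuum.NE9CurOfB11Chart (triple_read)
open B11Eq103H1Complex B11Eq115Space B11Eq174Chart
open B11Eq103H1Complex B11Eq115Space B11Eq174Chart
open B11Eq111FrakG (nabla115)
open B13Contraction113 (QuadAnalytic)
open B9SectCLatticeCarrier (Bond bpos btgt unshift)
open B4Sect5Torus (TSite)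
open B7Prop1Explicit (U1 Wcx boxVec)
open B7Prop2Explicit (pdev AvgClosed C0 c2' unitaryUnits avgClosed_unitaryUnits unitaryUnits_le_U1)
open B7Prop3Flat (c3)
open B9Eq315QTorus (perCfg cornerSite)
open B9Eq315QTower (towerP UlevOf)
open B9Eq326OperatorTower (QkW QkW_surjective laplaceAk)
open B9Eq310HessianOperator (adTransportW)
open B9Eq310DeltaPrime (plaqHolU)
open B9Eq324DeltaPrimeATower (laplacePrimeAk)
open B9Eq3119DeltaPiTower (laplaceAkPi)
open B11Eq44COperatorTower (αT αT_le ulev_mem_U1_of_pdev)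
open B11Eq44COperatorTowerGeometric (ulev_reg_of_pdev_geometric geomProfile_nonneg geomProfile_le_αT sum_geomProfile_le)
open B11Eq44CLetterTower (Cck)
open B9Thm311SmallFieldClosed (hRS_of_unitary)
open B9Eq315QTorusOnto (liftSite perSite_liftSite)
open B7Eq43AveragedSmallnessLevelFree (pdev_perCfg_le_of_plaq)
open B7Eq43AveragedSmallnessLinearFeed (twoWindows_linear_feed)
open B9Thm311SitePrimeFormCoerciveTowerCanonical (exists_strong_site_coercive_tower_diagonal)
open B9Thm311LaplaceAkPiPositiveDiagonal (exists_laplaceAkPi_pos_diagonal_closed)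
open B9Thm311LaplaceAkPositiveDiagonal (exists_laplaceAk_pos_diagonal_closed)
open B9Eq326OperatorTowerRealityUnitary (UlevOf_star_eq_inv forall_star_eq_inv_of_mem)
open B9Eq342GreenPrimeSupBound (norm_adTransportW_eq)
open Summit.QuantumFields.BalabanUV.T4Continuum.NE9CurChartTowerPiLatticeUniformClassW80 (cur_chart_exists_tower_pi_of_unitary_class_lattice_uniform_W80)
open B11Eq80Current (W80)
open B11Eq63V0GroupCurrent (curV0)
open B11Eq44CLetterTower (Cck)
open Summit.QuantumFields.BalabanUV.T4Continuum.NE9CurOfOneInstanceChartEnd (termSize_ne9_and_fadingMemory_compCur_of_chart)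

variable {C₀ : Carriers} {E : Type} [NormedAddCommGroup E] [NormedSpace ℂ E] {ι' αι β γ δ : Type} [DecidableEq δ]

variable (G : ClusterGeom (doubleCarriers C₀)) {Pot : Type*} [NormedAddCommGroup Pot] [NormedSpace ℂ Pot]

variable {d : ℕ} (hd : 1 ≤ d) (L : ℕ) [NeZero L] (hL : 1 ≤ L) (hL2 : 2 ≤ L) (hL3 : 3 ≤ L) [Fact (0 < (L : ℝ))]
  {𝔸 : Type*} [CStarAlgebra 𝔸] [Nontrivial 𝔸] [FiniteDimensional ℂ 𝔸]
  {W : Type*} [NormedAddCommGroup W] [InnerProductSpace ℂ W] [FiniteDimensional ℂ W] (φ : W ≃ₗ[ℂ] 𝔸)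
  {Mφ Mφ' : ℝ} (hMφ : 0 ≤ Mφ) (hMφ' : 0 ≤ Mφ') (hφ : ∀ w, ‖φ w‖ ≤ Mφ * ‖w‖) (hφ' : ∀ X, ‖φ.symm X‖ ≤ Mφ' * ‖X‖)
  {a : ℝ} (ha : 0 < a) {a' : ℝ} (ha' : 0 < a')
  (τ : 𝔸 →ₗ[ℂ] ℂ) {Cτ : ℝ} (hτ : ∀ X, ‖τ X‖ ≤ Cτ * ‖X‖) (hCτ : 0 ≤ Cτ) {Mτ : ℝ} (hτm : ∀ X Y : 𝔸, ‖τ (X * Y)‖ ≤ Mτ * ‖X‖ * ‖Y‖) (hMτ : 0 ≤ Mτ)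
  {ρw : ℝ} (hρw : 0 ≤ ρw)
  (hτ₁ : ∀ X : 𝔸, τ (star X) = conj (τ X)) (hτ₂ : ∀ X Y : 𝔸, τ (X * Y) = τ (Y * X)) (hφτ : ∀ X Y : 𝔸, ⟪φ.symm X, φ.symm Y⟫_ℂ = τ (star X * Y))
  {α₀ : ℝ} (hα₀ : 0 < α₀) (hα3 : C0 d * α₀ ≤ 1 / 3) (hα4 : 4 * α₀ ≤ c2' d L)
  (hαL : 50 * (d + 1) * αT d L α₀ * (L : ℝ) ^ d ≤ 1 / 2)
  {ρ : ℝ} (hρ0 : 0 < ρ) (hρ : Real.exp (4 * (800 * ((d : ℝ) + 1) ^ 2 * ((d : ℝ) + 4)) * α₀) * (1 + 8 * (131072 * ((d : ℝ) + 1) ^ 2) * ρ) ≤ 2)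
  (hρ4 : 4 * ρ ≤ c3 d L) (hθ : 2 * d * B7Prop5GeneralLevels.thetaGen d L α₀ ≤ (L : ℝ) ^ 3 / 16) (hC3 : 2 * d * B7Prop5GeneralLevels.C3Gen d L * ρ ≤ 1)
  {CV RV Mr Mt MJ MΔ : ℝ} (hCV : 0 ≤ CV) (hRV : 0 < RV) (hMr : 0 ≤ Mr) (hMt : 0 ≤ Mt) (hMJ : 0 ≤ MJ) (hMΔ : 0 ≤ MΔ) {ωw Ωw : ℝ} (hω : 0 ≤ ωw) (hΩ : 0 ≤ Ωw)

-- deep definitional unfolding `laplaceAkPi` ↦ `laplaceALatticeK … (π†Δπ) …` in the statement (as the host)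
set_option maxRecDepth 8192 in
set_option maxHeartbeats 1600000 in -- (I-7)'s ≈ 60-binder theorem + END-COMP's ≈ 50 binders, applied once each
include hd hL2 hL3 hMφ hMφ' hφ hφ' ha ha' hτ hCτ hτm hMτ hρw hτ₁ hτ₂ hφτ hα₀ hα3 hα4 hαL hρ0 hρ hρ4 hθ hC3 hω hΩ hCV hRV hMr hMt hMJ hMΔ in
/-- **T25's END FACE AT THE LATTICE-UNIFORM k-LEVEL CHART ON PRINT's CLASS** — (I-7) (`∃` radii BEFORE the lattice; `∃ h52 hpos′ hposπ` per lattice) and (C′) §1 at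
every `Φ` agreeing with the read chart: `TermSize ∧ NE9 ∧ FadingMemory` with END-COMP's moduli VERBATIM «⇐ the named binders». [folklore]
[cite: Balaban1985BackgroundPropagators, (3.122) p.420, (3.35)–(3.37) p.396, Thm 3.13 p.426; Balaban1985Variational, (103) p.293, Prop. 6 (117)–(121) p.295, (172)–(175) p.305; Balaban1987RG1, (1.18) p.256, Lemma 4 (3.53) p.280; Balaban1988RG2Cluster, Lemma 1 (1.36), Lemma 2 (1.41)–(1.43)] -/
theorem termSize_ne9_and_fadingMemory_compCur_of_towerPi_lattice_uniform_W80
    -- END-COMP's binders NOT mentioning the curve datum, verbatim (bound names as in (C′) ∕ (C″))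
    {Dd : RemData C₀ E ι' αι β γ δ} {R₁ : C₀.Dom → ℝ} {ℓg : ℕ → ℕ → ℝ} {cdir d0 : ℝ}
    {Ef : Functional (doubleCarriers C₀) E} {Wd : Set (ℕ → ℝ)} {Adm S : Set (E → (doubleCarriers C₀).Dom → ℝ)}
    {r : ℕ → (E → (doubleCarriers C₀).Dom → ℝ) → ℝ} {A : E → (doubleCarriers C₀).Dom → ℝ}
    {ΨF : ℕ → ℝ → (ι' → ℝ) → E → (doubleCarriers C₀).Dom → ℝ} {act : ℕ → ℝ → E → Pot → G.P → ℂ} {𝒜 : ℕ → Set Pot}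
    {n : ℕ → ℝ → E → G.P → ℝ} {lip clip : ℕ → ℝ} {aP dP : G.P → ℝ} {δv : (doubleCarriers C₀).Dom → ℝ}
    {κw O1 cQ ω clipd Nbar B lipbar clipbar cr aA : ℝ} {p₀ N : ℕ → ℝ}
    (ρP : ℕ → (ι' → ℝ) → Pot) (U₀ : E) (explZ : ℕ → E → (doubleCarriers C₀).Dom → ℝ) (h0 : ScaleZeroFree Ef Wd)
    (hAdm : AdmissibleTerms Ef Wd Adm) (hres : AdmRestrict Adm)
    (hDd : Dd.Admissible ℓg cdir d0) (hdirB0 : ∀ k s y a' b x, 0 < Dd.dirB k s y a' b x)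
    (hdirC : ∀ k s y a' b x, Continuous fun p : ℂ × (δ → ℝ) × (δ → ℂ) => Dd.dir k s y a' b x p.1 p.2.1 p.2.2)
    (hdirB : ∀ k s y a' b x t s' σ', ‖Dd.dir k s y a' b x t s' σ'‖ ≤ Dd.dirB k s y a' b x)
    (hrA : ReadAdditive Adm r) (hr0 : ReadZero r) (hrs : ReadSize Adm r κw cr) (hA : DirSize A κw aA) (hcr : 0 ≤ cr)
    (haA : 0 ≤ aA)
    (hAmul : ∀ c : ℕ → ℝ, (fun U X' => c ((doubleCarriers C₀).scale X') * A U X') ∈ Adm)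
    (hcoef : ∀ (j : ℕ) (c : ℝ), r j (restrictScale j (c • A)) = c * r j (restrictScale j A))
    (hnorm : ∀ j : ℕ, r j (restrictScale j A) = 1 ∨ ∀ H ∈ Adm, r j (restrictScale j H) = 0)
    (hS : ∀ H ∈ Adm, margProj r A H ∈ S)
    (hclipd : 0 ≤ clipd) (hcdir : 0 < cdir) (hℓpos : ∀ k j, 0 < ℓg k j) (hhalf : ∀ k j, cdir * ℓg k j < 1 / 2)
    (hcont : ∀ (k : ℕ) (s : ℕ → ℝ) (y : ι') (a' : αι) (b : β) (x : (doubleCarriers C₀).Dom),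
      ContinuousOn (fun p : ℂ × ((δ → ℝ) × (δ → ℂ)) => Dd.dir k s y a' b x p.1 p.2.1 p.2.2)
        (sphere (0:ℂ) (Dd.r k) ×ˢ {q | OnContour Dd.κ₁ (Dd.cubes k y a' b) q.1 q.2}))
    (hlip : ∀ g ∈ Wd, ∀ g' ∈ Wd, ∀ (k : ℕ) (y : ι'), ∀ a' ∈ Dd.S0 k y, ∀ b ∈ Dd.SY k y a', ∀ (j : ℕ), ∀ x ∈ Dd.src k y a' j,
      ∀ t ∈ sphere (0:ℂ) (Dd.r k), ∀ (s' : δ → ℝ) (σ' : δ → ℂ), OnContour Dd.κ₁ (Dd.cubes k y a' b) s' σ' →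
        ‖Dd.dir k g y a' b x t s' σ' - Dd.dir k g' y a' b x t s' σ'‖ ≤ clipd * (cdir * ℓg k j * Dd.R x.1) * |g k - g' k|)
    (hO1 : 0 ≤ O1) (hcQ : 0 ≤ cQ) (hω0 : 0 ≤ ω) (hω1 : ω < 1) (hNb : ∀ j, N j ≤ Nbar) (hclip0 : ∀ k, 0 ≤ clip k)
    (hCup : ∀ g ∈ Wd, ∀ g' ∈ Wd, ∀ (k : ℕ) (Ue : E) (X : (doubleCarriers C₀).Dom), (doubleCarriers C₀).scale X = k + 1 →
      ∀ Q ∈ 𝒜 k, ∀ γ' ∈ G.vol X,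
      ‖act k (g k) Ue Q γ'‖ ≤ n k (g' k) Ue γ' ∧
        ‖act k (g k) Ue Q γ' - act k (g' k) Ue Q γ'‖ ≤ clip k * |g k - g' k| * n k (g' k) Ue γ')
    (hreprV : ∀ (k : ℕ) (s : ℝ) (Q : ι' → ℝ) (Ue : E) (X : (doubleCarriers C₀).Dom),
      ΨF k s Q Ue X = (G.newTerm act k s Ue X (ρP k Q)).re - (G.newTerm act k s U₀ X (ρP k Q)).re + explZ k Ue X)
    (hclipb : ∀ k, clip k ≤ clipbar)
    (hK : TwoPointKP G Wd act 𝒜 n lip aP dP) (hdec : G.DecayExtract δv dP) (hpin : G.PinBudget aP δv (fun _ => B) κw)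
    (hexplZ : ∀ (k : ℕ) (Ue : E) (X : (doubleCarriers C₀).Dom), (doubleCarriers C₀).scale X = k + 1 →
      |explZ k Ue X| ≤ Real.exp (-(κw * (doubleCarriers C₀).d X)) * p₀ k)
    (hbase : ∀ g ∈ Wd, ∀ (Ue : E) (X : (doubleCarriers C₀).Dom), (doubleCarriers C₀).scale X = 0 →
      |Ef g Ue X| ≤ Real.exp (-(κw * (doubleCarriers C₀).d X)) * N 0)
    (hNsucc : ∀ j, p₀ j + 2 * B ≤ N (j + 1)) (hNnn : ∀ j, 0 ≤ N j)
    (hB : 0 ≤ B) (hlipb : ∀ k, lip k ≤ lipbar) (hposω : 0 < ω + 8 * lipbar * B * ((1 + cr * aA) * cQ)) :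
    ∃ α₁ j₁ ε₄ εC Rb R' : ℝ, 0 < α₁ ∧ 0 < j₁ ∧ 0 < Rb ∧ 0 < R' ∧
      ∀ (n : ℕ) (η : ℝ) [Fact (0 < η)] (hηL : η * (L : ℝ) ^ (n + 1) = 1) (c₀ c₁ : ℝ) [Fact (0 < c₀)] [Fact (0 < c₁)]
        (_hw : c₀ * ((L : ℝ) ^ (n + 1)) ^ d = c₁) (_hc₀η : c₀ = η ^ d) (_hρ : |η| ^ d / c₀ ≤ ρw) (m : Fin d → ℕ) [∀ i, NeZero (m i)] (_hm : ∀ i, 1 ≤ m i)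
        (U : Bond d (towerP L m (n + 1)) → 𝔸ˣ) (hUG : ∀ (x : B7Prop1Explicit.Site d) (κ : Fin d), perCfg (towerP L m (n + 1)) U x κ ∈ unitaryUnits 𝔸)
        (α : ℝ) (_hα : 0 ≤ α) (_hαle : α ≤ α₁) (_hUη : ∀ b, ‖(U b : 𝔸) - 1‖ ≤ α * η)
        (_hpl : ∀ p : B9SectCLatticeCarrier.Plaq d (towerP L m (n + 1)), ‖(plaqHolU U p : 𝔸) - 1‖ ≤ α * η ^ 2)
        (_hUgrad : ∀ (x : TSite d (towerP L m (n + 1))) (μ : Fin d), ‖(U (x, μ) : 𝔸) - U (unshift μ x, μ)‖ ≤ α * η ^ 2)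
        (j₀ : ℝ) (_hJ : ∀ μ y, ‖B9Eq39Adjoint.J (fun μ => B9Eq33CovDerivVector.shiftEquiv μ) (fun μ y => U (y, μ)) η μ y‖ ≤ j₀) (_hj : j₀ ≤ j₁)
        (lev₀ : Bond d (towerP L m (n + 1)) → ℕ) (lev₁ : Bond d (towerP L m (n + 1)) × Fin d → ℕ) (levB : Bond d m → ℕ) (_hlev : ∀ b, n + 1 ≤ lev₀ b)
        (_hw₀ : (NegSup.wSup (levWeight (L : ℝ) η lev₀ 1) : ℝ) ≤ ωw) (_hw₁ : (NegSup.wSup (levWeight (L : ℝ) η lev₁ 2) : ℝ) ≤ ωw)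
        (_hw₃ : (NegSup.wInvSup (levWeight (L : ℝ) η lev₀ 3) : ℝ) ≤ Ωw) (_hwB : (NegSup.wInvSup (levWeight (L : ℝ) η levB 0) : ℝ) ≤ Ωw)
        (ρc : (𝔸 →L[ℂ] ℂ) →L[ℂ] 𝔸) (τc : 𝔸 →L[ℂ] ℂ) (_hρc : ‖ρc‖ ≤ Mr) (_hτc : ‖τc‖ ≤ Mt)
        (_hqV : ∀ Y : Space115 (L : ℝ) η lev₀ lev₁ (nabla115 η U), ‖Y‖ < RV → ‖curV0 (lev₁ := lev₁) (Dc := nabla115 η U) ρc τc U Y‖ ≤ CV * ‖Y‖ ^ 2)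
        (J : NegSize (L : ℝ) η lev₀ 3 𝔸) (Δπ : Space115 (L : ℝ) η lev₀ lev₁ (nabla115 η U) →L[ℂ] NegSize (L : ℝ) η lev₀ 3 𝔸) (_hJn : ‖J‖ ≤ MJ) (_hΔn : ‖Δπ‖ ≤ MΔ),
      ∃ h52 : pdev (perCfg (towerP L m (n + 1)) U) < α₀ * (((L : ℝ) ^ (n + 1))⁻¹) ^ 2,
      ∃ hpos' : ∀ x : SiteL2K ℂ d (towerP L m (n + 1)) c₀ W, x ≠ 0 →
          0 < RCLike.re ⟪x, laplacePrimeAk L m n φ η U a' (c₁ := c₁) x⟫_ℂ,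
      ∃ hposπ : ∀ x : BondL2K ℂ d (towerP L m (n + 1)) c₀ W, x ≠ 0 →
          0 < RCLike.re ⟪x, laplaceAkPi L m n φ τ η U a' hpos' hL (fun j => αT d L α₀ * (((L : ℝ) ^ min (j + 1) (n + 1))⁻¹) ^ 2)
            (fun j => (geomProfile_le_αT (d := d) L (n + 1) hL hα₀.le j).trans (αT_le hL hα4))
            (ulev_mem_U1_of_pdev L m (n + 1) U hL2 (avgClosed_unitaryUnits d L) hUG hα₀ hα3 hα4 h52)
            (ulev_reg_of_pdev_geometric L m (n + 1) U hL2 (avgClosed_unitaryUnits d L) hUG hα₀ hα3 hα4 h52) (c₁ := c₁) a x⟫_ℂ,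
      let Hc := H1LatticeCLM (lev₀ := lev₀) (levB := levB) φ hposπ
              (QkW_surjective L m n φ U hL _ _ _ _ fun j => le_trans (mul_le_mul_of_nonneg_right (mul_le_mul_of_nonneg_left
                (geomProfile_le_αT (d := d) L (n + 1) hL hα₀.le j) (by positivity)) (by positivity)) hαL) lev₁ (nabla115 η U)
      let Gc := frakGLatticeCLM (lev₀ := lev₀) φ hposπ
              (QkW_surjective L m n φ U hL _ _ _ _ fun j => le_trans (mul_le_mul_of_nonneg_right (mul_le_mul_of_nonneg_left
                (geomProfile_le_αT (d := d) L (n + 1) hL hα₀.le j) (by positivity)) (by positivity)) hαL) lev₁ (nabla115 η U)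
      let Cx := Cck L m η (n + 1) U lev₀ lev₁ (nabla115 η U) levB
      ∀ (ιr : C₀.Dom → (E →L[ℂ] NegSize (L : ℝ) η levB 0 𝔸)) (πr : C₀.Dom → (Space115 (L : ℝ) η lev₀ lev₁ (nabla115 η U) →L[ℂ] E)),
          (∀ X, MapsTo (ιr X) (ball 0 (Dd.R X)) (ball 0 Rb)) → (∀ X, MapsTo (πr X) (ball 0 R') (ball 0 (R₁ X))) →
          ∀ (Φ : C₀.Dom → E → E), (∀ X e, Φ X e = πr X (chartHB Gc 0 (W80 ρc τc U (H1LatticeCLM (lev₀ := lev₀) (levB := levB) φ hposπ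
              (QkW_surjective L m n φ U hL _ _ _ _ fun j => le_trans (mul_le_mul_of_nonneg_right (mul_le_mul_of_nonneg_left
                (geomProfile_le_αT (d := d) L (n + 1) hL hα₀.le j) (by positivity)) (by positivity)) hαL) lev₁ (nabla115 η U))
              (Cck L m η (n + 1) U lev₀ lev₁ (nabla115 η U) levB) εC J Δπ) 0 (fun A' => A' + solA Hc 0 Cx 0 εC A') ε₄ Hc (ιr X e))) →
          -- END-COMP's binders that mention the curve datum `Dd.compCur Φ R₁`
          LevelCountsG (Dd.compCur Φ R₁).toC.frame κw (Dd.compCur Φ R₁).κ₁ O1 cQ (fun k j => ℓg k j ^ 5) (agePow ω) →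
          Adm ⊆ analyticClass (Dd.compCur Φ R₁).R → A ∈ analyticClass (Dd.compCur Φ R₁).R →
          Factorises Ef Wd (compProj (cpieceChannel (Dd.compCur Φ R₁).toC) (margProj r A)) ΨF →
          (∀ (k : ℕ) (Q Q' : ι' → ℝ) (M : ℝ),
            (∀ y, |Q y - Q' y| ≤ weightOf (Dd.compCur Φ R₁).toC.frame (Dd.compCur Φ R₁).κ₁ d0 O1 ((Dd.compCur Φ R₁).Kp cdir) k y
              * M) → ‖ρP k Q - ρP k Q'‖ ≤ M) →
          (∀ (k : ℕ) (Q : ι' → ℝ),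
            (∀ y, |Q y| ≤ weightOf (Dd.compCur Φ R₁).toC.frame (Dd.compCur Φ R₁).κ₁ d0 O1 ((Dd.compCur Φ R₁).Kp cdir) k y *
              sizeRadius (fun k j => (1 + cr * aA) * tauOfG cQ (agePow ω) k j) N k) → ρP k Q ∈ 𝒜 k) →
          TermSize Ef Wd κw N ∧
            NE9 Ef Wd κw (prodModuli (8 * clipbar * B + 8 * lipbar * B *
                ((64 * (4 * clipd) * Nbar + cr * Nbar * (64 * (4 * clipd) * aA)) * cQ * (1 - ω)⁻¹))
              fun _ => ω + 8 * lipbar * B * ((1 + cr * aA) * cQ)) ∧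
              FadingMemory ((8 * clipbar * B + 8 * lipbar * B *
                    ((64 * (4 * clipd) * Nbar + cr * Nbar * (64 * (4 * clipd) * aA)) * cQ * (1 - ω)⁻¹)) /
                  (ω + 8 * lipbar * B * ((1 + cr * aA) * cQ)))
                (ω + 8 * lipbar * B * ((1 + cr * aA) * cQ))
                (prodModuli (8 * clipbar * B + 8 * lipbar * B *
                    ((64 * (4 * clipd) * Nbar + cr * Nbar * (64 * (4 * clipd) * aA)) * cQ * (1 - ω)⁻¹))
                  fun _ => ω + 8 * lipbar * B * ((1 + cr * aA) * cQ)) := by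
  obtain ⟨α₁, j₁, ε₄, εC, Rb, R', hα₁, hj₁, hRb0, hR'0, HC⟩ :=
    cur_chart_exists_tower_pi_of_unitary_class_lattice_uniform_W80 hd L hL hL2 hL3 φ hMφ hMφ' hφ hφ' ha ha' τ hτ hCτ hτm hMτ hρw hτ₁ hτ₂ hφτ hα₀ hα3 hα4 hαL
      hρ0 hρ hρ4 hθ hC3 hω hΩ hCV hRV hMr hMt hMJ hMΔ
  refine ⟨α₁, j₁, ε₄, εC, Rb, R', hα₁, hj₁, hRb0, hR'0, ?_⟩
  intro n η _ hηL c₀ c₁ _ _ hw hc₀η hρ' m _ hm U hUG α hα0 hαle hUη hpl hUgrad j₀ hJ hj' lev₀ lev₁ levB hlev hw₀ hw₁ hw₃ hwB ρc τc hρc' hτc' hqV J Δπ hJn hΔn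
  obtain ⟨h52, hpos', hposπ, hΨ1, hΨ2, hΨ3⟩ :=
    HC n η hηL c₀ c₁ hw hc₀η hρ' m hm U hUG α hα0 hαle hUη hpl hUgrad j₀ hJ hj' lev₀ lev₁ levB hlev hw₀ hw₁ hw₃ hwB ρc τc hρc' hτc' hqV J Δπ hJn hΔn
  refine ⟨h52, hpos', hposπ, ?_⟩
  intro Hc Gc Cx ιr πr hιr hπr Φ hΦ hLev hAdmAn hAan hfac hρQ hbox
  exact termSize_ne9_and_fadingMemory_compCur_of_chart G hΨ1 hΨ2 hΨ3 ιr πr hιr hπr hΦ ρP U₀ explZ h0 hAdm hres hDd hdirB0 hdirC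
    hdirB hLev hAdmAn hrA hr0 hrs hA hcr haA hAan hAmul hcoef hnorm hS hclipd hcdir hℓpos hhalf hcont hlip hO1 hcQ hω0 hω1 hNb hfac
    hclip0 hCup hreprV hclipb hK hdec hpin hρQ hexplZ hbase hNsucc hNnn hbox hB hlipb hposω

end Summit.QuantumFields.BalabanUV.T4Continuum.NE9CurOfTowerPiChartEndLatticeUniformW80

end
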